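import Mathlib.Combinatorics.SetFamily.Compression.Down
import Mathlib.Tactic
import HarnessLib
import HarnessLib.Audit.Tags
import Summits.CriticalPhenomena.PercolationContinuityZ3.Theorems.PercNearOneGluingNoHeavyLowerTailSahiRainbowTwoColourThird

/-!
# The sparse residual is LOCAL, 0: vocabulary (no-twin, S₁, D and Q points, bisections)

Support file (seat `prim-masterthm-p1`, gen 42; `--supports stmt-CriticalPhenomena-4575`).  No `sorry`, standard axioms.
Blueprint `run/shared/lean/prim/prim-masterthm/FROM-prim-masterthm-p1-g42-*.md` (PROOFS §0–§1).

SETTING (`…SahiRainbowTwoColour{,Twins,Sparse,TwinPoint}`): `Z = X ⊔ Y ⊆ 2^G` complement-closed, `L = monoMeets X Y`,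
`D_y = bothLifts Z y` (doubled lower members at `y`), `twins_y = bothLifts L y`.  `SparseTwinPoint` asks, for a configuration
with `0 < #D_y < 6` at every point, for ONE point with `#D_y ≤ 2 · #twins_y`.  Call a point DEFICIT if `0 < #D_y < 6` and
`2 · #twins_y < #D_y`.  THIS GENERATION PROVES THAT NO THREE POINTS OF A CONFIGURATION CAN BE DEFICIT (for `#G ≥ 4`), which
settles `SparseTwinPoint` (file `…DeficitFinal`).  The whole argument is LOCAL: it only uses the doubled members at the two or
three points involved and the absence of non-empty twins there.

THIS FILE (vocabulary for the local analysis; companion `…TwoColourDeficitLocal` proves the structure theorem):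
* `NoTwin L y` — every colour `c ∌ y` with `insert y c` a colour is `∅`;
* `S1At X Y G y P Q` (**S₁-point**): upper members `P ∈ X`, `Q ∈ Y` forming a BICOLOURED bisection through `y`
  (`P ∩ Q = {y}`, `P ∪ Q = G`), lower members in `Z`, `{y} ∉ L`, `NoTwin`;
* `Bisect C Z G y A A'`: a monochromatic bisection through `y` in the class `C` with lower members in `Z`;
* `DAt` (**D-point**): an `X`-bisection and a `Y`-bisection, `{y} ∈ L`, `NoTwin`; `Q3At K K'` (**Q-point**): `{y} ∈ K`,
  `G ∈ K'`, `G ∖ y ∈ Z`, a `K`-bisection, `{y} ∈ L`, `NoTwin`;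
* symmetries (`swap`), elementary consequences, and facts about doubled members / upper classes at a point with
  `twins ⊆ {∅}` (same upper colour ⟹ disjoint; bisections from doubled pairs).
HONEST FRAMING: unconditional elementary lemmas. [this work]
-/

namespace Summit.CriticalPhenomena.PercolationContinuityZ3.Theorems.SahiColouredDaykin

open Finset
open scoped FinsetFamily

variable {α : Type*} [DecidableEq α]

/-! ### 1. No non-empty twin at a point -/

/-- `NoTwin L y`: the only colour `c ∌ y` with `insert y c ∈ L` is `c = ∅` (no non-empty twin at `y`). [this work] -/
def NoTwin (L : Finset (Finset α)) (y : α) : Prop := ∀ ⦃c : Finset α⦄, c ∈ L → insert y c ∈ L → y ∉ c → c = ∅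

/-- Using `NoTwin`: a non-empty twin is absurd. [this work] -/
theorem NoTwin.elim {L : Finset (Finset α)} {y : α} (h : NoTwin L y) {c : Finset α} (hc : c ∈ L) (hc' : insert y c ∈ L)
    (hy : y ∉ c) (hne : c.Nonempty) : False := by
  have := h hc hc' hy; subst this; exact Finset.not_nonempty_empty hne

/-- `NoTwin` from `twins ⊆ {∅}`. [this work] -/
theorem noTwin_of_bothLifts_subset {L : Finset (Finset α)} {y : α} (h : bothLifts L y ⊆ {∅}) : NoTwin L y :=
  fun _ hc hc' hy => mem_singleton.1 (h (mem_bothLifts.2 ⟨hy, hc, hc'⟩))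

/-- Meets of distinct members of `X` are colours. [this work] -/
theorem inter_mem_monoMeets_left {X Y : Finset (Finset α)} {a b : Finset α} (ha : a ∈ X) (hb : b ∈ X) (hab : a ≠ b) :
    a ∩ b ∈ monoMeets X Y :=
  mem_monoMeets.2 (Or.inr (Or.inl (inter_mem_pairMeets ha hb hab)))

/-- Meets of distinct members of `Y` are colours. [this work] -/
theorem inter_mem_monoMeets_right {X Y : Finset (Finset α)} {a b : Finset α} (ha : a ∈ Y) (hb : b ∈ Y) (hab : a ≠ b) :
    a ∩ b ∈ monoMeets X Y :=
  mem_monoMeets.2 (Or.inr (Or.inr (inter_mem_pairMeets ha hb hab)))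

/-! ### 2. The three local shapes -/

/-- **S₁-point**: one doubled antipodal pair; the two upper members `P ∈ X`, `Q ∈ Y` form a bicoloured bisection through
`y`; `{y}` is not a colour and there is no non-empty twin at `y`. [this work] -/
structure S1At (X Y : Finset (Finset α)) (G : Finset α) (y : α) (P Q : Finset α) : Prop where
  /-- `P` is in the first class -/
  memP : P ∈ X
  /-- `Q` is in the second class -/
  memQ : Q ∈ Y
  /-- `y ∈ P` -/
  y_mem_P : y ∈ P
  /-- `y ∈ Q` -/
  y_mem_Q : y ∈ Q
  /-- bisection: meet -/
  inter_eq : P ∩ Q = {y}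
  /-- bisection: union -/
  union_eq : P ∪ Q = G
  /-- lower member of `P` -/
  erase_P : P.erase y ∈ X ∪ Y
  /-- lower member of `Q` -/
  erase_Q : Q.erase y ∈ X ∪ Y
  /-- `{y}` is not a colour -/
  singleton_notMem : {y} ∉ monoMeets X Y
  /-- no non-empty twin -/
  noTwin : NoTwin (monoMeets X Y) y

/-- A monochromatic bisection through `y` inside the class `C`, with both lower members in `Z`. [this work] -/
structure Bisect (C Z : Finset (Finset α)) (G : Finset α) (y : α) (A A' : Finset α) : Prop where
  /-- first member -/
  mem : A ∈ C
  /-- second member -/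
  mem' : A' ∈ C
  /-- `y ∈ A` -/
  y_mem : y ∈ A
  /-- `y ∈ A'` -/
  y_mem' : y ∈ A'
  /-- meet -/
  inter_eq : A ∩ A' = {y}
  /-- union -/
  union_eq : A ∪ A' = G
  /-- lower member of `A` -/
  erase_mem : A.erase y ∈ Z
  /-- lower member of `A'` -/
  erase_mem' : A'.erase y ∈ Z

/-- **D-point**: a monochromatic `X`-bisection and a monochromatic `Y`-bisection through `y` (among the upper members), `{y}`
a colour, no non-empty twin. [this work] -/
structure DAt (X Y : Finset (Finset α)) (G : Finset α) (y : α) (A A' B B' : Finset α) : Prop where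
  /-- the `X`-bisection -/
  bisX : Bisect X (X ∪ Y) G y A A'
  /-- the `Y`-bisection -/
  bisY : Bisect Y (X ∪ Y) G y B B'
  /-- `{y}` is a colour -/
  singleton_mem : {y} ∈ monoMeets X Y
  /-- no non-empty twin -/
  noTwin : NoTwin (monoMeets X Y) y

/-- **Q-point** (relative to the ordered pair of classes `(K, K')`): `{y} ∈ K`, `G ∈ K'`, `G.erase y ∈ Z`, a monochromatic
`K`-bisection through `y`, `{y}` a colour, no non-empty twin. [this work] -/
structure Q3At (K K' : Finset (Finset α)) (G : Finset α) (y : α) (C C' : Finset α) : Prop where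
  /-- `{y}` is a member of colour `K` -/
  single_mem : {y} ∈ K
  /-- `G` is a member of colour `K'` -/
  univ_mem : G ∈ K'
  /-- `G ∖ y` is a member -/
  erase_univ_mem : G.erase y ∈ K ∪ K'
  /-- the `K`-bisection -/
  bis : Bisect K (K ∪ K') G y C C'
  /-- `{y}` is a colour -/
  singleton_mem : {y} ∈ monoMeets K K'
  /-- no non-empty twin -/
  noTwin : NoTwin (monoMeets K K') y

/-! ### 3. Symmetries -/

/-- Swapping the colour classes in an S₁-point. [this work] -/
theorem S1At.swap {X Y : Finset (Finset α)} {G : Finset α} {y : α} {P Q : Finset α} (h : S1At X Y G y P Q) :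
    S1At Y X G y Q P where
  memP := h.memQ
  memQ := h.memP
  y_mem_P := h.y_mem_Q
  y_mem_Q := h.y_mem_P
  inter_eq := by rw [inter_comm]; exact h.inter_eq
  union_eq := by rw [union_comm]; exact h.union_eq
  erase_P := by rw [union_comm]; exact h.erase_Q
  erase_Q := by rw [union_comm]; exact h.erase_P
  singleton_notMem := by rw [monoMeets_comm]; exact h.singleton_notMem
  noTwin := by rw [monoMeets_comm]; exact h.noTwin

/-- Swapping the two members of a bisection. [this work] -/
theorem Bisect.swap {C Z : Finset (Finset α)} {G : Finset α} {y : α} {A A' : Finset α} (h : Bisect C Z G y A A') :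
    Bisect C Z G y A' A where
  mem := h.mem'
  mem' := h.mem
  y_mem := h.y_mem'
  y_mem' := h.y_mem
  inter_eq := by rw [inter_comm]; exact h.inter_eq
  union_eq := by rw [union_comm]; exact h.union_eq
  erase_mem := h.erase_mem'
  erase_mem' := h.erase_mem

/-- A bisection with `Z` rewritten. [this work] -/
theorem Bisect.of_eq {C Z Z' : Finset (Finset α)} {G : Finset α} {y : α} {A A' : Finset α} (h : Bisect C Z G y A A')
    (e : Z = Z') : Bisect C Z' G y A A' := e ▸ h

/-- Swapping the colour classes in a D-point. [this work] -/
theorem DAt.swap {X Y : Finset (Finset α)} {G : Finset α} {y : α} {A A' B B' : Finset α} (h : DAt X Y G y A A' B B') :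
    DAt Y X G y B B' A A' where
  bisX := h.bisY.of_eq (union_comm X Y)
  bisY := h.bisX.of_eq (union_comm X Y)
  singleton_mem := by rw [monoMeets_comm]; exact h.singleton_mem
  noTwin := by rw [monoMeets_comm]; exact h.noTwin

/-! ### 4. Elementary consequences of a bisection -/

section BisectFacts

variable {C Z : Finset (Finset α)} {G : Finset α} {y : α} {A A' : Finset α}

/-- The second member of a bisection is the complement of the first with `y` added. [this work] -/
theorem Bisect.eq_insert_sdiff (h : Bisect C Z G y A A') : A' = insert y (G \ A) := by
  ext t
  have h1 := congrArg (t ∈ ·) h.inter_eq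
  have h2 := congrArg (t ∈ ·) h.union_eq
  simp only [mem_inter, mem_singleton, mem_union, eq_iff_iff] at h1 h2
  simp only [mem_insert, mem_sdiff]
  constructor
  · intro ht
    by_cases hta : t ∈ A
    · exact Or.inl (h1.1 ⟨hta, ht⟩)
    · exact Or.inr ⟨h2.1 (Or.inr ht), hta⟩
  · rintro (rfl | ⟨htG, hta⟩)
    · exact h.y_mem'
    · rcases h2.2 htG with h' | h'
      · exact absurd h' hta
      · exact h'

/-- Members of a bisection lie in `G`. [this work] -/
theorem Bisect.subset (h : Bisect C Z G y A A') : A ⊆ G := by rw [← h.union_eq]; exact subset_union_left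

/-- `y ∈ G`. [this work] -/
theorem Bisect.y_mem_G (h : Bisect C Z G y A A') : y ∈ G := h.subset h.y_mem

/-- Membership in the second member. [this work] -/
theorem Bisect.mem'_iff (h : Bisect C Z G y A A') {t : α} : t ∈ A' ↔ t = y ∨ (t ∈ G ∧ t ∉ A) := by
  rw [h.eq_insert_sdiff, mem_insert, mem_sdiff]

/-- The two members are distinct (when `A ≠ {y}` or `G ≠ {y}`; we only need: `A ≠ A'` as soon as `G.erase y` is non-empty).
[this work] -/
theorem Bisect.ne (h : Bisect C Z G y A A') (hG : (G.erase y).Nonempty) : A ≠ A' := by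
  intro e
  obtain ⟨t, ht⟩ := hG
  rw [mem_erase] at ht
  have h2 := congrArg (t ∈ ·) h.union_eq
  have h1 := congrArg (t ∈ ·) h.inter_eq
  simp only [mem_inter, mem_singleton, mem_union, eq_iff_iff, ← e, or_self, and_self] at h1 h2
  exact ht.1 (h1.1 (h2.2 ht.2))

end BisectFacts


/-! ### 5. Doubled members: elementary facts -/

section Doubled

variable {G : Finset α} {K K' : Finset (Finset α)} {y : α}

/-- A doubled lower member lies in `G.erase y`. [this work] -/
theorem subset_erase_of_mem_bothLifts (hZG : ∀ z ∈ K ∪ K', z ⊆ G) {d : Finset α} (hd : d ∈ bothLifts (K ∪ K') y) :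
    d ⊆ G.erase y := by
  obtain ⟨hyd, hdZ, -⟩ := mem_bothLifts.1 hd
  intro t ht
  exact mem_erase.2 ⟨fun h => hyd (h ▸ ht), hZG d hdZ ht⟩

/-- A doubled lower member is in one of the two upper classes. [this work] -/
theorem mem_upperClass_or {d : Finset α} (hd : d ∈ bothLifts (K ∪ K') y) :
    d ∈ upperClass (K ∪ K') K y ∨ d ∈ upperClass (K ∪ K') K' y := by
  rw [← upperClass_union K K' y] at hd; exact mem_union.1 hd

/-- Upper classes consist of doubled members. [this work] -/
theorem mem_bothLifts_of_mem_upperClass {C : Finset (Finset α)} {d : Finset α} (hd : d ∈ upperClass (K ∪ K') C y) :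
    d ∈ bothLifts (K ∪ K') y := (mem_filter.1 hd).1

/-- At a point with `twins ⊆ {∅}`, two distinct doubled members with the same upper colour (first class) are disjoint.
[this work] -/
theorem inter_eq_empty_of_upperClass_left (htw : bothLifts (monoMeets K K') y ⊆ {∅}) {d e : Finset α}
    (hd : d ∈ upperClass (K ∪ K') K y) (he : e ∈ upperClass (K ∪ K') K y) (hde : d ≠ e) : d ∩ e = ∅ :=
  mem_singleton.1 (htw (pairMeets_upperClass_subset_twins K K' y (inter_mem_pairMeets hd he hde)))

/-- The same for the second class. [this work] -/
theorem inter_eq_empty_of_upperClass_right (htw : bothLifts (monoMeets K K') y ⊆ {∅}) {d e : Finset α}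
    (hd : d ∈ upperClass (K ∪ K') K' y) (he : e ∈ upperClass (K ∪ K') K' y) (hde : d ≠ e) : d ∩ e = ∅ :=
  mem_singleton.1 (htw (pairMeets_upperClass_union_subset_twins K K' y
    (mem_union_right _ (inter_mem_pairMeets hd he hde))))

/-- **Bisection from a doubled pair with the same upper colour.** [this work] -/
theorem bisect_of_upperClass (hy : y ∈ G) {C : Finset (Finset α)} {d : Finset α} (hdG : d ⊆ G.erase y)
    (hd : d ∈ upperClass (K ∪ K') C y) (hd' : (G.erase y) \ d ∈ upperClass (K ∪ K') C y) :
    Bisect C (K ∪ K') G y (insert y d) (insert y ((G.erase y) \ d)) := by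
  obtain ⟨hdD, hdC⟩ := mem_filter.1 hd
  obtain ⟨hd'D, hd'C⟩ := mem_filter.1 hd'
  obtain ⟨hyd, hdZ, -⟩ := mem_bothLifts.1 hdD
  obtain ⟨hyd', hd'Z, -⟩ := mem_bothLifts.1 hd'D
  refine ⟨hdC, hd'C, mem_insert_self _ _, mem_insert_self _ _, ?_, ?_, ?_, ?_⟩
  · rw [← insert_inter_distrib, inter_sdiff_self, insert_empty]
  · rw [← insert_union_distrib, union_sdiff_of_subset hdG, insert_erase hy]
  · rw [erase_insert hyd]; exact hdZ
  · rw [erase_insert hyd']; exact hd'Z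

/-- `insert y ∅ = {y}` is a member of the upper class's colour. [this work] -/
theorem singleton_mem_of_upperClass {C : Finset (Finset α)} (h : (∅ : Finset α) ∈ upperClass (K ∪ K') C y) :
    ({y} : Finset α) ∈ C := by
  have := (mem_filter.1 h).2; rwa [insert_empty] at this

/-- `insert y (G.erase y) = G` is a member of the upper class's colour. [this work] -/
theorem univ_mem_of_upperClass (hy : y ∈ G) {C : Finset (Finset α)} (h : G.erase y ∈ upperClass (K ∪ K') C y) :
    G ∈ C := by
  have := (mem_filter.1 h).2; rwa [insert_erase hy] at this

end Doubled

/-- Propositional helper: `¬(a ↔ b) → ¬(b ↔ c) → (a ↔ c)`. [this work] -/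
theorem iff_of_not_iff {a b c : Prop} (h₁ : ¬ (a ↔ b)) (h₂ : ¬ (b ↔ c)) : (a ↔ c) := by
  by_cases ha : a <;> by_cases hb : b <;> by_cases hc : c <;> simp_all

/-- Propositional helper: `(a ↔ b) → ¬(a ↔ a') → ¬(b ↔ b') → (a' ↔ b')`. [this work] -/
theorem iff_of_iff_of_not_iff {a a' b b' : Prop} (h : (a ↔ b)) (h₁ : ¬ (a ↔ a')) (h₂ : ¬ (b ↔ b')) : (a' ↔ b') := by
  by_cases ha : a <;> by_cases ha' : a' <;> by_cases hb : b <;> by_cases hb' : b' <;> simp_all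

end Summit.CriticalPhenomena.PercolationContinuityZ3.Theorems.SahiColouredDaykin
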